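import Mathlib
import HarnessLib
import Literature.NumberTheory.LFunctions.ZetaScrew
import Summits.RiemannHypothesis.RiemannHypothesis.Theorems.IntegerScrewPivotLogBound

/-!
# Route `IntegerScrew` — the LEADING TERM from below: `2Ψ(h) ≥ h·log(1/h) − 9h`, hence the
# increment energy `2Ψ(log(M/(M−1)))` lies between `(log(M−1))/M − 9/(M−1)` and `(log M + 4)/(M−1)`

Companion of `IntegerScrewPivotLogBound.lean` (`two_zetaScrew_le_log`: `2Ψ(t) ≤ t log(1/t) + 4t`).
The pivot law of HOME/pivot/PIVOT-LAW.md reads `M·d_M = L(M) − G(M)` with the trial-vector energy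
`L(M) = M·2Ψ(h_M)`, `h_M = log(M/(M−1))`, and the DERIVED expansion `L(M) = log M − c₀ + o(1)`,
`c₀ = log 2π + γ₀ − 1`. The upper half of «`L(M) = log M + O(1)`» is in the tree; this file proves
the lower half, with a crude constant, by elementary estimates on the prime-free wall formula
`Ψ(t) = 4(e^{t/2} + e^{−t/2} − 2) − (t/2)κ + ¼(C − e^{−t/2}Φ(e^{−2t},2,¼))`
(`zetaScrew_eq_of_abs_lt_log_two`; `κ = γ₀ + π/2 + 3 log 2 + log π`, `C = Σ_k (k+¼)^{−2}`):

* `sub_hurwitzLerchQuarter_ge` : `C − Φ(e^{−2t},2,¼) ≥ 2t·log(1/t) − 6t` for `0 < t ≤ 1`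
  (keep the terms `1 ≤ k ≤ ⌊1/t⌋`, bound `1 − e^{−2tk} ≥ 2tk − 4t²k²` (from `e^{x} ≥ 1 + x`), `k/(k+¼)² ≥ 1/(k+1)`,
  `H_{J+1} − 1 ≥ log(J+2) − 1 ≥ log(1/t) − 1`, and `Σ_{k≤J} 4t²k²/(k+¼)² ≤ 4t²J ≤ 4t`);
* `screwSlope_lt_six` : `κ < 6`;
* **`two_zetaScrew_ge_log`** : `2Ψ(t) ≥ t·log(1/t) − 9t` for `0 < t ≤ 1/2`
  (archimedean part `≥ 0`, `e^{−t/2}Φ ≤ Φ`; true constant `−c₀ = −1.415…`);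
* **`two_zetaScrew_log_div_ge`** : `(log(M−1))/M − 9/(M−1) ≤ 2Ψ(log(M/(M−1)))` for `M ≥ 3`.

With `screwPivot_le_two_zetaScrew_log_div` / `screwPivot_le_log_div` this brackets the trial
energy that bounds every pivot: `M·2Ψ(h_M) = log M + O(1)` two-sidedly, kernel-checked. No statement
here involves the zeros of `ζ`; under RH it says the bound `d_M ≤ 2Ψ(h_M)` used by the pivot law is
itself of exact order `log M / M`. Reference: M. Suzuki, J. Lond. Math. Soc. (2) 108 (2023) =
arXiv:2206.03682, (1.1) and the proof of Thm 4.1 (the wall) [Suzuki2023].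
-/

noncomputable section

-- D-0017: `Summit.<S>.<S>.…` is the designed namespace of a single-problem summit.
set_option linter.dupNamespace false

namespace Summit.RiemannHypothesis.RiemannHypothesis.Theorems.IntegerScrew

open Literature.NumberTheory.LFunctions Finset
open scoped BigOperators

/-! ### Elementary inequalities -/

/-- `κ = γ₀ + π/2 + 3 log 2 + log π < 6` (`γ₀ < 2/3`, `π < 3.15`, `log 2 < 0.6932`, `log π < log 4`).
[folklore] -/
theorem screwSlope_lt_six :
    Real.eulerMascheroniConstant + Real.pi / 2 + 3 * Real.log 2 + Real.log Real.pi < 6 := by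
  have hγ := Real.eulerMascheroniConstant_lt_two_thirds
  have hπ := Real.pi_lt_d2
  have h2 := Real.log_two_lt_d9
  have hlogπ : Real.log Real.pi < 2 * Real.log 2 := by
    rw [← Real.log_rpow two_pos, Real.log_lt_log_iff Real.pi_pos (by positivity)]
    have : (2 : ℝ) ^ (2 : ℝ) = 4 := by norm_num
    linarith [Real.pi_lt_four]
  linarith

/-! ### The Hurwitz–Lerch term from below -/

/-- The partial sums `Σ_{i<J} 1/(i+2) ≥ log(J+2) − 1` (`= H_{J+1} − 1`, `H_n ≥ log(n+1)`). [folklore] -/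
theorem log_sub_one_le_sum (J : ℕ) :
    Real.log ((J : ℝ) + 2) - 1 ≤ ∑ i ∈ range J, 1 / ((i : ℝ) + 2) := by
  have hH : ∀ n : ℕ, ((harmonic n : ℚ) : ℝ) = ∑ i ∈ range n, 1 / ((i : ℝ) + 1) := by
    intro n
    induction n with
    | zero => simp
    | succ n ih =>
      rw [harmonic_succ, sum_range_succ, Rat.cast_add, ih]
      push_cast
      ring
  have h1 := log_add_one_le_harmonic (J + 1)
  rw [hH (J + 1), sum_range_succ'] at h1
  push_cast at h1
  have e : ∑ i ∈ range J, 1 / ((i : ℝ) + 1 + 1) = ∑ i ∈ range J, 1 / ((i : ℝ) + 2) :=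
    sum_congr rfl fun i _ => by ring
  rw [e] at h1
  have e2 : ((J : ℝ) + 1 + 1) = (J : ℝ) + 2 := by ring
  rw [e2] at h1
  norm_num at h1
  simp only [one_div] at h1 ⊢
  linarith

/-- `C − Φ(e^{−2t},2,¼) = Σ_{k≥0}(1 − e^{−2tk})(k+¼)^{−2} ≥ 2t·log(1/t) − 6t` for `0 < t ≤ 1`. [folklore] -/
theorem sub_hurwitzLerchQuarter_ge {t : ℝ} (ht : 0 < t) (ht1 : t ≤ 1) :
    2 * t * Real.log (1 / t) - 6 * t ≤
      (∑' k : ℕ, 1 / ((k : ℝ) + 1 / 4) ^ 2) - hurwitzLerchQuarter t := by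
  have hs := summable_one_div_nat_add_quarter_sq
  have hsΦ := summable_hurwitzLerchQuarter t
  set u : ℕ → ℝ := fun k => (1 - Real.exp (-(2 * |t| * k))) / ((k : ℝ) + 1 / 4) ^ 2 with hu
  have hdiff : (∑' k : ℕ, 1 / ((k : ℝ) + 1 / 4) ^ 2) - hurwitzLerchQuarter t = ∑' k, u k := by
    rw [hurwitzLerchQuarter, ← hs.tsum_sub hsΦ]
    refine tsum_congr fun k => ?_
    rw [hu]
    ring
  rw [hdiff]
  have habs : |t| = t := abs_of_pos ht
  have hu_nonneg : ∀ k, 0 ≤ u k := fun k => by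
    rw [hu]
    apply div_nonneg _ (by positivity)
    rw [sub_nonneg, Real.exp_le_one_iff]
    have : 0 ≤ 2 * |t| * k := by positivity
    linarith
  have hsu : Summable u := by
    refine hs.of_norm_bounded fun k => ?_
    rw [Real.norm_eq_abs, abs_of_nonneg (hu_nonneg k), hu]
    refine div_le_div_of_nonneg_right ?_ (by positivity)
    linarith [Real.exp_pos (-(2 * |t| * k))]
  -- keep the terms 1 ≤ k ≤ J, J = ⌊1/t⌋
  set J : ℕ := ⌊1 / t⌋₊ with hJ
  have hJle : (J : ℝ) ≤ 1 / t := Nat.floor_le (by positivity)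
  have hJlt : 1 / t < (J : ℝ) + 1 := Nat.lt_floor_add_one _
  have hJt : (J : ℝ) * t ≤ 1 := by
    have := mul_le_mul_of_nonneg_right hJle ht.le
    rwa [one_div, inv_mul_cancel₀ ht.ne'] at this
  -- termwise lower bound for 1 ≤ k ≤ J, written with k = i + 1
  have hterm : ∀ i ∈ range J,
      2 * t * (1 / ((i : ℝ) + 2)) - 4 * t ^ 2 ≤ u (i + 1) := by
    intro i hi
    simp only [mem_range] at hi
    rw [hu]
    simp only [Nat.cast_add, Nat.cast_one, habs]
    have hk : (0 : ℝ) ≤ (i : ℝ) := Nat.cast_nonneg i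
    set k : ℝ := (i : ℝ) + 1 with hk'
    have hk1 : 1 ≤ k := by rw [hk']; linarith
    have hx : 0 ≤ 2 * t * k := by positivity
    -- `1 − e^{−y} ≥ y − y²` for `y ≥ 0` (from `e^{y} ≥ 1 + y`; cf. the tree's
    -- `Literature.Barriers.CriticalPhenomena.sub_sq_le_one_sub_exp_neg`, not imported here)
    have h1 : 2 * t * k - (2 * t * k) ^ 2 ≤ 1 - Real.exp (-(2 * t * k)) := by
      set y : ℝ := 2 * t * k with hy
      have e1 : Real.exp (-y) ≤ 1 / (1 + y) := by
        rw [Real.exp_neg, one_div]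
        exact inv_anti₀ (by linarith) (by linarith [Real.add_one_le_exp y])
      have e2 : y - y ^ 2 ≤ 1 - 1 / (1 + y) := by
        rw [show 1 - 1 / (1 + y) = y / (1 + y) by field_simp; ring]
        rw [le_div_iff₀ (by linarith)]
        nlinarith [sq_nonneg y]
      linarith
    -- (2tk − 4t²k²)/(k+¼)² ≥ 2t/(k+1) − 4t²
    have hden : 0 < (k + 1 / 4) ^ 2 := by positivity
    have hA : 2 * t * (1 / (k + 1)) ≤ 2 * t * k / (k + 1 / 4) ^ 2 := by
      rw [mul_one_div, div_le_div_iff₀ (by linarith) hden]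
      nlinarith
    have hB : (2 * t * k) ^ 2 / (k + 1 / 4) ^ 2 ≤ 4 * t ^ 2 := by
      rw [div_le_iff₀ hden]
      nlinarith [sq_nonneg t]
    have hk2 : (i : ℝ) + 2 = k + 1 := by rw [hk']; ring
    rw [hk2]
    calc 2 * t * (1 / (k + 1)) - 4 * t ^ 2
        ≤ 2 * t * k / (k + 1 / 4) ^ 2 - (2 * t * k) ^ 2 / (k + 1 / 4) ^ 2 := by linarith
      _ = (2 * t * k - (2 * t * k) ^ 2) / (k + 1 / 4) ^ 2 := by ring
      _ ≤ (1 - Real.exp (-(2 * t * k))) / (k + 1 / 4) ^ 2 :=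
          div_le_div_of_nonneg_right h1 hden.le
  -- sum over i < J and compare with the tsum
  have hsum : ∑ i ∈ range J, u (i + 1) ≤ ∑' k, u k := by
    have h1 : ∑ i ∈ range J, u (i + 1) = ∑ k ∈ Finset.image (· + 1) (range J), u k := by
      rw [sum_image fun a _ b _ h => by simpa using h]
    rw [h1]
    exact hsu.sum_le_tsum _ fun k _ => hu_nonneg k
  have hlow : ∑ i ∈ range J, (2 * t * (1 / ((i : ℝ) + 2)) - 4 * t ^ 2)
      ≤ ∑ i ∈ range J, u (i + 1) := sum_le_sum hterm
  rw [sum_sub_distrib, sum_const, card_range, ← mul_sum, nsmul_eq_mul] at hlow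
  have hlog := log_sub_one_le_sum J
  have hlogJ : Real.log (1 / t) ≤ Real.log ((J : ℝ) + 2) :=
    Real.log_le_log (by positivity) (by linarith)
  have hlog0 : 0 ≤ Real.log (1 / t) := Real.log_nonneg (by rw [le_div_iff₀ ht]; linarith)
  have hJ4 : (J : ℝ) * (4 * t ^ 2) ≤ 4 * t := by nlinarith
  calc 2 * t * Real.log (1 / t) - 6 * t
      ≤ 2 * t * (Real.log ((J : ℝ) + 2) - 1) - (J : ℝ) * (4 * t ^ 2) := by nlinarith
    _ ≤ 2 * t * ∑ i ∈ range J, 1 / ((i : ℝ) + 2) - (J : ℝ) * (4 * t ^ 2) := by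
        have := mul_le_mul_of_nonneg_left hlog (show 0 ≤ 2 * t by positivity); linarith
    _ ≤ ∑ i ∈ range J, u (i + 1) := hlow
    _ ≤ ∑' k, u k := hsum

/-! ### The bound on `Ψ` from below -/

/-- **`2Ψ(t) ≥ t·log(1/t) − 9t` for `0 < t ≤ ½`** (prime-free wall; the true expansion is
`2Ψ(t) = t log(1/t) − (log 2π + γ₀ − 1)t + O(t²)`, so only the leading term is sharp). [folklore] -/
theorem two_zetaScrew_ge_log {t : ℝ} (ht : 0 < t) (ht2 : t ≤ 1 / 2) :
    t * Real.log (1 / t) - 9 * t ≤ 2 * zetaScrew t := by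
  have habs : |t| = t := abs_of_pos ht
  have hlt : |t| < Real.log 2 := by
    rw [habs]; have := Real.log_two_gt_d9; linarith
  rw [zetaScrew_eq_of_abs_lt_log_two hlt, habs]
  have hA : 0 ≤ 4 * (Real.exp (t / 2) + Real.exp (-(t / 2)) - 2) := by
    have h := Real.add_one_le_exp (t / 2)
    have h' := Real.add_one_le_exp (-(t / 2))
    have hprod : Real.exp (t / 2) * Real.exp (-(t / 2)) = 1 := by
      rw [← Real.exp_add]; simp
    nlinarith [sq_nonneg (Real.exp (t / 2) - Real.exp (-(t / 2))), Real.exp_pos (t / 2),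
      Real.exp_pos (-(t / 2))]
  have hκ := screwSlope_lt_six
  have hΦ0 := hurwitzLerchQuarter_nonneg t
  have hL := sub_hurwitzLerchQuarter_ge ht (by linarith)
  have hexp1 : Real.exp (-(t / 2)) ≤ 1 := by rw [Real.exp_le_one_iff]; linarith
  have hmix : (∑' k : ℕ, 1 / ((k : ℝ) + 1 / 4) ^ 2) - hurwitzLerchQuarter t ≤
      (∑' k : ℕ, 1 / ((k : ℝ) + 1 / 4) ^ 2) - Real.exp (-(t / 2)) * hurwitzLerchQuarter t := by
    nlinarith
  have hlog0 : 0 ≤ Real.log (1 / t) := Real.log_nonneg (by rw [le_div_iff₀ ht]; linarith)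
  nlinarith

/-! ### The increment energy of the pivot law from below -/

/-- **`(log(M−1))/M − 9/(M−1) ≤ 2Ψ(log(M/(M−1)))` for `M ≥ 3`** (`h_M = log(M/(M−1)) ∈ [1/M, 1/(M−1)]`
and `two_zetaScrew_ge_log`); with `screwPivot_le_log_div` the trial energy `2Ψ(h_M)` that bounds
every pivot `d_M` is of exact order `log M / M`. [folklore] -/
theorem two_zetaScrew_log_div_ge (M : ℕ) (hM : 3 ≤ M) :
    Real.log ((M : ℝ) - 1) / M - 9 / ((M : ℝ) - 1)
      ≤ 2 * zetaScrew (Real.log ((M : ℝ) / ((M : ℝ) - 1))) := by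
  have hM' : (3 : ℝ) ≤ (M : ℝ) := by exact_mod_cast hM
  have hM1 : (0 : ℝ) < (M : ℝ) - 1 := by linarith
  have hM0 : (0 : ℝ) < (M : ℝ) := by linarith
  set x : ℝ := (M : ℝ) / ((M : ℝ) - 1) with hx
  have hx_pos : 0 < x := by positivity
  have hx1 : x - 1 = 1 / ((M : ℝ) - 1) := by rw [hx]; field_simp; ring
  have hxinv : 1 - x⁻¹ = 1 / (M : ℝ) := by rw [hx]; field_simp; ring
  set hh : ℝ := Real.log x with hhdef
  have hh_le : hh ≤ 1 / ((M : ℝ) - 1) := by rw [hhdef, ← hx1]; exact Real.log_le_sub_one_of_pos hx_pos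
  have hh_ge : 1 / (M : ℝ) ≤ hh := by rw [hhdef, ← hxinv]; exact Real.one_sub_inv_le_log_of_pos hx_pos
  have hh_pos : 0 < hh := lt_of_lt_of_le (by positivity) hh_ge
  have hh_half : hh ≤ 1 / 2 := le_trans hh_le (by
    rw [div_le_div_iff_of_pos_left one_pos hM1 (by norm_num)]; linarith)
  have hΨ := two_zetaScrew_ge_log hh_pos hh_half
  -- log(1/hh) ≥ log(M−1) ≥ 0 and hh ≥ 1/M
  have hlog : Real.log ((M : ℝ) - 1) ≤ Real.log (1 / hh) := by
    apply Real.log_le_log hM1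
    rw [le_div_iff₀ hh_pos]
    have := mul_le_mul_of_nonneg_left hh_le hM1.le
    rw [one_div, mul_inv_cancel₀ hM1.ne'] at this
    linarith
  have hlogM1 : 0 ≤ Real.log ((M : ℝ) - 1) := Real.log_nonneg (by linarith)
  have h1 : Real.log ((M : ℝ) - 1) / M ≤ hh * Real.log (1 / hh) := by
    calc Real.log ((M : ℝ) - 1) / M = 1 / (M : ℝ) * Real.log ((M : ℝ) - 1) := by ring
      _ ≤ hh * Real.log (1 / hh) := mul_le_mul hh_ge hlog hlogM1 hh_pos.le
  have h2 : 9 * hh ≤ 9 / ((M : ℝ) - 1) := by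
    have := mul_le_mul_of_nonneg_left hh_le (show (0 : ℝ) ≤ 9 by norm_num)
    rwa [mul_one_div] at this
  linarith

end Summit.RiemannHypothesis.RiemannHypothesis.Theorems.IntegerScrew
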